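import Summits.AtomisticToContinuum.FouriersLaw.Theorems.EmbeddedDrudeMourreDrudeDissolutionStubGramContinuityTransferData
import Literature.MathematicalPhysics.KineticTheory.InfiniteChainShiftInvariantUniqueness
import Literature.Probability.LatticeModels.MarkovChainMixing
import HarnessLib

/-!
# Stub G `stub_gramContinuity`, tool 5: the thermal states of the coupling ray are the two-sided
Markov chains of the uniform transfer data — window formula and UNIFORM exponential mixing
(line `gram-pencil-harmonic-chaos`, crux `EmbeddedDrudeMourre.DrudeDissolution`,
item stmt-AtomisticToContinuum-12593; `--supports` file, closes nothing)

WHAT. For `ω₂ > 0`, `a, b ≥ 0` there are transfer data `λ(ε)`, `h_ε` (`ε ∈ [0, 1]`; continuous in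
`ε`, `0 < h_ε ≤ B`, `λ ≥ λ_min > 0`) and ONE rate `m > 0` such that for every `ε ∈ [0, 1]` EVERY
shift-invariant DLR Gibbs state `μ` of `pinnedChain ω₂ (aε) (bε) 1` at `T = 1`
(i) integrates window observables against the explicit window densities
`h_ε(σ_a) h_ε(σ_{a+n}) ∏ K_ε λ(ε)⁻¹ ∏ w_ε` of the two-sided stationary Markov chain, and
(ii) is exponentially `ρ`-mixing between `L²` observables of `{i ≤ a}` and `{i ≥ a + n}` with the
constants `(2, m)` INDEPENDENT of `ε` (`pencil_markov_state`, registered sub-goal of stub G).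

WHY. (ii) is the uniform clustering input of clause (ii) of stub G; (i) (with `B`, `λ_min` uniform and
`h_ε`, `λ` continuous) gives the uniform moment bounds of clause (i) and the continuity in `ε` of
the finite-dimensional marginals of clause (iii).

PROOF. The construction of `…GreenKuboContinuation.TemperatureBlindVitaliHurwitz.exists_regular_state_mixing`
re-run with the uniform data of `pencil_transfer_data` (tool 4) in place of
`exists_groundState_markov_gap`: `ennreal_transferData`, `exists_markovChainMeasure`,
`isChainGibbsMeasure_of_windowDensity`, `isShiftInvariant_of_windowDensity`, identification with
the given state by `eq_of_isChainGibbsMeasure_of_isShiftInvariant_pinnedChain`, and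
`abs_integral_mul_sub_le_of_dependsOn_halfLine`.
-/

noncomputable section

open MeasureTheory Set Filter Function Topology
open scoped InnerProductSpace ENNReal
open Literature.MathematicalPhysics.KineticTheory
open Literature.MathematicalPhysics.KineticTheory.HeatConduction
open Literature.MathematicalPhysics.KineticTheory.HeatConduction.OscillatorChain
open Literature.Probability.LatticeModels

namespace Summit.AtomisticToContinuum.FouriersLaw.Theorems.DrudeDissolution.GramPencilHarmonicChaos

/-- **The thermal states of the coupling ray as Markov chains of the uniform transfer data:
window formula and uniform exponential mixing** (named-hypotheses form of the registered
`pencil_markov_state`). [folklore] -/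
theorem pencil_markov_state' {ω₂ a b : ℝ} (hω : 0 < ω₂) (ha : 0 ≤ a) (hb : 0 ≤ b) :
    ∃ (lam : ℝ → ℝ) (h : ℝ → ℝ × ℝ → ℝ) (B m lmin : ℝ), 0 < m ∧ 0 < lmin ∧
      ContinuousOn lam (Set.Icc 0 1) ∧ (∀ z, ContinuousOn (fun ε => h ε z) (Set.Icc 0 1)) ∧
      ∀ ε ∈ Set.Icc (0 : ℝ) 1, lmin ≤ lam ε ∧ Measurable (h ε) ∧ (∀ z, 0 < h ε z) ∧
        (∀ z, h ε z ≤ B) ∧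
        ∀ μ : Measure ChainConfig, (pinnedChain ω₂ (a * ε) (b * ε) 1).IsChainGibbsMeasure 1 μ →
          IsShiftInvariant μ →
          (∀ (k : ℝ × ℝ → ℝ × ℝ → ℝ≥0∞) (φ w : ℝ × ℝ → ℝ≥0∞) (L : ℝ≥0∞)
              (D : ℤ → ℕ → ChainConfig → ℝ≥0∞),
            (∀ z z', k z z' = ENNReal.ofReal (Real.exp (-(1 : ℝ)⁻¹ *
              (pinnedChain ω₂ (a * ε) (b * ε) 1).V (z'.1 - z.1)))) →
            (∀ z, φ z = ENNReal.ofReal (h ε z)) →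
            (∀ z, w z = ENNReal.ofReal (Real.exp (-(1 : ℝ)⁻¹ *
              (z.2 ^ 2 / 2 + (pinnedChain ω₂ (a * ε) (b * ε) 1).U z.1)))) →
            L = ENNReal.ofReal (lam ε) →
            (∀ a₀ n σ, D a₀ n σ = φ (σ a₀) * φ (σ (a₀ + n)) *
              (∏ j ∈ Finset.range n, k (σ (a₀ + j)) (σ (a₀ + j + 1)) * L⁻¹) *
              ∏ j ∈ Finset.range (n + 1), w (σ (a₀ + j))) →
            ∀ (a₀ : ℤ) (n : ℕ) (Φ : ChainConfig → ℝ≥0∞), Measurable Φ →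
              DependsOn Φ (↑(Finset.Icc a₀ (a₀ + n)) : Set ℤ) → ∀ η : ChainConfig,
                ∫⁻ σ, Φ σ ∂μ = (∫⋯∫⁻_Finset.Icc a₀ (a₀ + n), (fun σ => Φ σ * D a₀ n σ)
                  ∂fun _ : ℤ => (volume : Measure (ℝ × ℝ))) η) ∧
          ∀ (a₀ : ℤ) (n : ℕ) (f g : ChainConfig → ℝ),
            DependsOn f {i : ℤ | i ≤ a₀} → DependsOn g {i : ℤ | a₀ + n ≤ i} →
            Measurable f → Measurable g → MemLp f 2 μ → MemLp g 2 μ →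
              |∫ σ, f σ * g σ ∂μ - (∫ σ, f σ ∂μ) * (∫ σ, g σ ∂μ)| ≤
                2 * Real.exp (-(m * n)) * (∫ σ, f σ ^ 2 ∂μ) ^ (1 / 2 : ℝ) *
                  (∫ σ, g σ ^ 2 ∂μ) ^ (1 / 2 : ℝ) := by
  classical
  obtain ⟨lam, h, B, r, lmin, hr0, hr1, hlmin, hlamc, hhc, hall⟩ := pencil_transfer_data' hω ha hb
  -- the uniform rate
  set r' : ℝ := max r (1 / 2) with hr'
  have hr'0 : 0 < r' := lt_max_of_lt_right (by norm_num)
  have hr'1 : r' < 1 := max_lt hr1 (by norm_num)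
  have hrr' : r ≤ r' := le_max_left _ _
  refine ⟨lam, h, B, -Real.log r', lmin, neg_pos.2 (Real.log_neg hr'0 hr'1), hlmin, hlamc, hhc,
    fun ε hε => ?_⟩
  obtain ⟨hlamε, hhm, hhpos, hhle, hKw⟩ := hall ε hε
  have hlam : 0 < lam ε := hlmin.trans_le hlamε
  set P : OscillatorChain := pinnedChain ω₂ (a * ε) (b * ε) 1 with hP
  have haε : 0 ≤ a * ε := mul_nonneg ha hε.1
  have hbε : 0 ≤ b * ε := mul_nonneg hb hε.1
  have hUc : Continuous P.U := by
    show Continuous fun q : ℝ => ω₂ * q ^ 2 / 2 + a * ε * q ^ 4 / 4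
    fun_prop
  have hVc : Continuous P.V := by
    show Continuous fun r : ℝ => r ^ 2 / 2 + b * ε * r ^ 4 / 4
    fun_prop
  have hUm : Measurable P.U := hUc.measurable
  have hVm : Measurable P.V := hVc.measurable
  have hV0 : ∀ r, 0 ≤ P.V r := fun r => by
    show (0 : ℝ) ≤ r ^ 2 / 2 + b * ε * r ^ 4 / 4
    positivity
  have hVe : ∀ r, P.V (-r) = P.V r := fun r => by
    show (-r) ^ 2 / 2 + b * ε * (-r) ^ 4 / 4 = r ^ 2 / 2 + b * ε * r ^ 4 / 4
    ring
  have hUi : Integrable (fun q : ℝ => Real.exp (-(1 : ℝ)⁻¹ * P.U q)) :=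
    integrable_exp_neg_pinning one_pos hω haε (b * ε) 1
  -- the real transfer data
  obtain ⟨wt, hwt⟩ : ∃ wt : ℝ × ℝ → ℝ, ∀ z, wt z = Real.exp (-(1 : ℝ)⁻¹ * (z.2 ^ 2 / 2 + P.U z.1)) :=
    ⟨_, fun _ => rfl⟩
  have hwt_eq : wt = fun z => Real.exp (-(1 : ℝ)⁻¹ * (z.2 ^ 2 / 2 + P.U z.1)) := funext hwt
  have hwtc : Continuous wt := by rw [hwt_eq]; fun_prop
  have hwti : Integrable wt := by rw [hwt_eq]; exact P.integrable_siteWeight one_pos hUi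
  have hwtpos : ∀ z, 0 < wt z := fun z => by rw [hwt]; exact Real.exp_pos _
  obtain ⟨K, hK⟩ : ∃ K : ℝ × ℝ → ℝ × ℝ → ℝ, ∀ z z', K z z' = Real.exp (-(1 : ℝ)⁻¹ * P.V (z'.1 - z.1)) :=
    ⟨_, fun _ _ => rfl⟩
  have hKc : Continuous (uncurry K) := by
    rw [show uncurry K = fun p : (ℝ × ℝ) × (ℝ × ℝ) => Real.exp (-(1 : ℝ)⁻¹ * P.V (p.2.1 - p.1.1)) from
      funext fun p => hK p.1 p.2]
    fun_prop
  have hKpos : ∀ z z', 0 < K z z' := fun z z' => by rw [hK]; exact Real.exp_pos _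
  have hK0 : ∀ z z', 0 ≤ K z z' := fun z z' => (hKpos z z').le
  have hKC : ∀ z z', K z z' ≤ 1 := fun z z' => by
    rw [hK, Real.exp_le_one_iff]
    have := hV0 (z'.1 - z.1)
    nlinarith
  have hKsymm : ∀ z z', K z z' = K z' z := fun z z' => by
    rw [hK, hK, ← hVe (z.1 - z'.1), neg_sub]
  obtain ⟨heig, hnorm, hgapq⟩ := hKw K wt hK hwt
  refine ⟨hlamε, hhm, hhpos, hhle, fun μ hG hSI => ?_⟩
  -- the `ℝ≥0∞` transfer data and the two-sided stationary Markov chain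
  obtain ⟨k, hk⟩ : ∃ k : ℝ × ℝ → ℝ × ℝ → ℝ≥0∞, ∀ z z', k z z' = ENNReal.ofReal (K z z') :=
    ⟨_, fun _ _ => rfl⟩
  obtain ⟨φ, hφ⟩ : ∃ φ : ℝ × ℝ → ℝ≥0∞, ∀ z, φ z = ENNReal.ofReal (h ε z) := ⟨_, fun _ => rfl⟩
  obtain ⟨w, hw⟩ : ∃ w : ℝ × ℝ → ℝ≥0∞, ∀ z, w z = ENNReal.ofReal (wt z) := ⟨_, fun _ => rfl⟩
  obtain ⟨L, hL⟩ : ∃ L : ℝ≥0∞, L = ENNReal.ofReal (lam ε) := ⟨_, rfl⟩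
  obtain ⟨p, hp⟩ : ∃ p : ℝ × ℝ → ℝ × ℝ → ℝ≥0∞, ∀ x y, p x y = (φ x)⁻¹ * L⁻¹ * k x y * φ y * w y :=
    ⟨_, fun _ _ => rfl⟩
  obtain ⟨q, hq⟩ : ∃ q : ℝ × ℝ → ℝ × ℝ → ℝ, ∀ x y, q x y = (lam ε * h ε x)⁻¹ * K x y * h ε y * wt y :=
    ⟨_, fun _ _ => rfl⟩
  obtain ⟨D, hD⟩ : ∃ D : ℤ → ℕ → ChainConfig → ℝ≥0∞, ∀ a₀ n σ, D a₀ n σ = φ (σ a₀) * φ (σ (a₀ + n)) *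
      (∏ j ∈ Finset.range n, k (σ (a₀ + j)) (σ (a₀ + j + 1)) * L⁻¹) *
      ∏ j ∈ Finset.range (n + 1), w (σ (a₀ + j)) := ⟨_, fun _ _ _ => rfl⟩
  obtain ⟨hkm, hφm, hwm', -, -, -, -, hL0, hLt, heigE, hnormE⟩ :=
    ennreal_transferData (ν := (volume : Measure (ℝ × ℝ))) hKc.measurable hhm hwtc.measurable hK0
      hKC hhpos hhle hwtpos hwti hlam heig hnorm hk hφ hw hL
  have hsym : ∀ z y, k z y = k y z := fun z y => by rw [hk, hk, hKsymm]
  obtain ⟨μ', hμ'prob, hμ'⟩ := exists_markovChainMeasure (S := ℝ × ℝ)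
    (ν := (volume : Measure (ℝ × ℝ))) hkm hφm hwm' hL0 hLt heigE hsym hnormE hD
  haveI := hμ'prob
  -- `μ'` is a shift-invariant DLR state, hence equal to `μ`
  have hw'' : ∀ z, w z = ENNReal.ofReal (Real.exp (-(1 : ℝ)⁻¹ * (z.2 ^ 2 / 2 + P.U z.1))) :=
    fun z => by rw [hw, hwt]
  have hk'' : ∀ z z', k z z' = ENNReal.ofReal (Real.exp (-(1 : ℝ)⁻¹ * P.V (z'.1 - z.1))) :=
    fun z z' => by rw [hk, hK]
  have hfac : ∀ (Λ : Finset ℤ) (σ : ChainConfig),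
      ENNReal.ofReal (Real.exp (-(1 : ℝ)⁻¹ * hamiltonianIn P.chainPotential chainSupp Λ σ)) =
        (∏ x ∈ Λ, w (σ x)) * ∏ y ∈ bondSet Λ, k (σ y) (σ (y + 1)) := fun Λ σ => by
    rw [P.ofReal_exp_neg_hamiltonianIn 1 Λ σ]
    simp only [hw'', hk'']
  have hZ : ∀ (Λ : Finset ℤ) (η : ChainConfig), (∫⋯∫⁻_Λ, (fun σ =>
      ENNReal.ofReal (Real.exp (-(1 : ℝ)⁻¹ * hamiltonianIn P.chainPotential chainSupp Λ σ)))
      ∂fun _ : ℤ => (volume : Measure (ℝ × ℝ))) η ≠ ∞ := fun Λ η =>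
    (P.lmarginal_boltzmann_lt_top one_pos hV0 hUi Λ η).ne
  have hG' : P.IsChainGibbsMeasure 1 μ' :=
    P.isChainGibbsMeasure_of_windowDensity hUm hVm hkm hφm hwm' hD hfac hZ hμ'
  have hS' : IsShiftInvariant μ' := isShiftInvariant_of_windowDensity hkm hφm hwm' hD hμ'
  have hμμ' : μ = μ' :=
    eq_of_isChainGibbsMeasure_of_isShiftInvariant_pinnedChain 1 hω haε hbε one_pos hG hSI hG' hS'
  subst hμμ'
  refine ⟨fun k₁ φ₁ w₁ L₁ D₁ hk₁ hφ₁ hw₁ hL₁ hD₁ a₀ n Φ hΦm hΦd η => ?_,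
    fun a₀ n f g hfd hgd hfm hgm hf2 hg2 => ?_⟩
  · -- the window formula, for any spelling of the data
    have hDD : D₁ = D := by
      funext a₁ n₁ σ
      rw [hD₁, hD]
      simp only [hk₁, hk'', hφ₁, hφ, hw₁, hw'', hL₁, hL]
    rw [hDD]
    exact hμ' a₀ n Φ hΦm hΦd η
  · -- uniform exponential mixing
    have hmain := abs_integral_mul_sub_le_of_dependsOn_halfLine (S := ℝ × ℝ)
      (ν := (volume : Measure (ℝ × ℝ))) (μ := μ) hKc.measurable hhm hwtc.measurable hK0 hKC hhpos
      hhle hwtpos hwti hlam heig hnorm hKsymm hk hφ hw hL hp hq hD hμ' hr0 (hgapq q hq) hfm hfd hgm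
      hgd hf2 hg2
    have hexp : r ^ n ≤ Real.exp (-(-Real.log r' * n)) := by
      rw [neg_mul, neg_neg, mul_comm, Real.exp_nat_mul, Real.exp_log hr'0]
      exact pow_le_pow_left₀ hr0 hrr' n
    have hF : 0 ≤ (∫ σ, f σ ^ 2 ∂μ) ^ (1 / 2 : ℝ) :=
      Real.rpow_nonneg (integral_nonneg fun _ => sq_nonneg _) _
    have hG0 : 0 ≤ (∫ σ, g σ ^ 2 ∂μ) ^ (1 / 2 : ℝ) :=
      Real.rpow_nonneg (integral_nonneg fun _ => sq_nonneg _) _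
    refine hmain.trans ?_
    gcongr

/-- **The thermal states of the coupling ray as Markov chains of the uniform transfer data: window
formula and uniform exponential mixing** (registered sub-goal of stub G; see
`pencil_markov_state'`). [folklore] -/
theorem pencil_markov_state : ∀ ω₂ a b : ℝ, 0 < ω₂ → 0 ≤ a → 0 ≤ b →
    ∃ (lam : ℝ → ℝ) (h : ℝ → ℝ × ℝ → ℝ) (B m lmin : ℝ), 0 < m ∧ 0 < lmin ∧
      ContinuousOn lam (Set.Icc 0 1) ∧ (∀ z, ContinuousOn (fun ε => h ε z) (Set.Icc 0 1)) ∧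
      ∀ ε ∈ Set.Icc (0 : ℝ) 1, lmin ≤ lam ε ∧ Measurable (h ε) ∧ (∀ z, 0 < h ε z) ∧
        (∀ z, h ε z ≤ B) ∧
        ∀ μ : MeasureTheory.Measure Literature.MathematicalPhysics.KineticTheory.HeatConduction.ChainConfig,
          (Literature.MathematicalPhysics.KineticTheory.HeatConduction.pinnedChain
            ω₂ (a * ε) (b * ε) 1).IsChainGibbsMeasure 1 μ →
          Literature.MathematicalPhysics.KineticTheory.HeatConduction.IsShiftInvariant μ →
          (∀ (k : ℝ × ℝ → ℝ × ℝ → ENNReal) (φ w : ℝ × ℝ → ENNReal) (L : ENNReal)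
              (D : ℤ → ℕ → Literature.MathematicalPhysics.KineticTheory.HeatConduction.ChainConfig → ENNReal),
            (∀ z z', k z z' = ENNReal.ofReal (Real.exp (-(1 : ℝ)⁻¹ *
              (Literature.MathematicalPhysics.KineticTheory.HeatConduction.pinnedChain
                ω₂ (a * ε) (b * ε) 1).V (z'.1 - z.1)))) →
            (∀ z, φ z = ENNReal.ofReal (h ε z)) →
            (∀ z, w z = ENNReal.ofReal (Real.exp (-(1 : ℝ)⁻¹ * (z.2 ^ 2 / 2 +
              (Literature.MathematicalPhysics.KineticTheory.HeatConduction.pinnedChain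
                ω₂ (a * ε) (b * ε) 1).U z.1)))) →
            L = ENNReal.ofReal (lam ε) →
            (∀ a₀ n σ, D a₀ n σ = φ (σ a₀) * φ (σ (a₀ + n)) *
              (∏ j ∈ Finset.range n, k (σ (a₀ + j)) (σ (a₀ + j + 1)) * L⁻¹) *
              ∏ j ∈ Finset.range (n + 1), w (σ (a₀ + j))) →
            ∀ (a₀ : ℤ) (n : ℕ)
              (Φ : Literature.MathematicalPhysics.KineticTheory.HeatConduction.ChainConfig → ENNReal),
              Measurable Φ → DependsOn Φ (↑(Finset.Icc a₀ (a₀ + n)) : Set ℤ) →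
              ∀ η : Literature.MathematicalPhysics.KineticTheory.HeatConduction.ChainConfig,
                ∫⁻ σ, Φ σ ∂μ = MeasureTheory.lmarginal
                  (fun _ : ℤ => (MeasureTheory.volume : MeasureTheory.Measure (ℝ × ℝ)))
                  (Finset.Icc a₀ (a₀ + n)) (fun σ => Φ σ * D a₀ n σ) η) ∧
          ∀ (a₀ : ℤ) (n : ℕ)
            (f g : Literature.MathematicalPhysics.KineticTheory.HeatConduction.ChainConfig → ℝ),
            DependsOn f {i : ℤ | i ≤ a₀} → DependsOn g {i : ℤ | a₀ + n ≤ i} →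
            Measurable f → Measurable g → MeasureTheory.MemLp f 2 μ → MeasureTheory.MemLp g 2 μ →
              |∫ σ, f σ * g σ ∂μ - (∫ σ, f σ ∂μ) * (∫ σ, g σ ∂μ)| ≤
                2 * Real.exp (-(m * n)) * (∫ σ, f σ ^ 2 ∂μ) ^ (1 / 2 : ℝ) *
                  (∫ σ, g σ ^ 2 ∂μ) ^ (1 / 2 : ℝ) :=
  fun _ _ _ hω ha hb => pencil_markov_state' hω ha hb

end Summit.AtomisticToContinuum.FouriersLaw.Theorems.DrudeDissolution.GramPencilHarmonicChaos

end
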